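import Summits.HodgeConjecture.CorCM.MultiFieldWeilCubicTower
import Summits.HodgeConjecture.CorCM.MultiFieldWeilTwoSimpleThreefolds
import HarnessLib

/-!
# MULTI-FIELD WEIL ENGINE — THREE SIMPLE CM ABELIAN THREEFOLDS WHOSE SEXTIC CM FIELDS CONTAIN `k`, `Hom(K₁, K₀) = ∅` AND NO `k`-EMBEDDING OF `K₂` INTO
# `K₀ · K₁`: the Hodge conjecture for every product of copies of `E`, `T₀`, `T₁`, `T₂`, given ONLY Markman's fourfold theorem

Cell `pub-hodgecm2` (COR-CM), seat b30 gen 32 (2026-08-24); count-neutral own lane MULTI-FIELD WEIL ENGINE (stem `MultiFieldWeil*`), sequel of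
`CorCM/MultiFieldWeilCubicTower.lean` (§4 `hodgeConjectureFor_biproduct_comp_of_three_sextics`, engine form) and `CorCM/MultiFieldWeilTwoSimpleThreefolds.lean` (G4: the
one-member normalisation `exists_realisation_card_eq_one`, `card_filter_mem_eq_one_or_two_of_isSimple`, `exists_mem_cmType`).  Theorems only; no definition, no named
fact, no `sorry`.  HONEST FRAMING: conditional on the displayed Markman fourfold binder only; `HC_CM` is NOT proved and not asserted.

THE STATEMENT (**`hodgeConjectureFor_biproduct_comp_vec_of_three_simpleThreefolds_of_markman`**, + dominated).  `k` imaginary quadratic, `E ⊨ (k; Ψ)`;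
`T_m ⊨ (K_m; Φ_m)` (`m = 0, 1, 2`) SIMPLE abelian threefolds with CM by sextic CM fields `K_m ⊇ i_m(k)`; HYPOTHESES ON THE FIELDS ONLY: `Hom(K₁, K₀) = ∅`, and
`K₂` admits no `k`-embedding into any compositum `K₀ · K₁` — precisely: for all complex embeddings `τ, s₀ ⊃ τ, s₁ ⊃ τ` of `k, K₀, K₁`, no embedding of `K₂` over
`τ` has image inside `ℚ(τk) · s₀(K₀) · s₁(K₁)`.  Then for every `κ : Fin N → Fin 4` the Hodge conjecture holds for `⨁_j ![E, T₀, T₁, T₂] (κ j)` — every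
`E^a × T₀^b × T₁^c × T₂^d` — GIVEN ONLY `Markman2025_weilClasses_algebraic_abelianFourfold`.  (Pairwise non-isomorphy of `K₀, K₁, K₂` is NOT enough for three
fields: `CorCM/MultiFieldWeilCubicTower.lean`.)  The types are normalised to one member over `τ` on the same varieties (G4), then the cubic tower applies.

[cite: Markman2025SurveySecant, Thm. 1.2] [cite: Shimura1998, §8.2 Prop. 26, §8.4, §18.2 Lemma (i)] [cite: Lang2002, V §1 Prop. 1.2, VI §1 Thm. 1.1]

## References
* [Markman2025SurveySecant] E. Markman, arXiv:2509.23403, Thm. 1.2.  [Shimura1998] G. Shimura, *Abelian varieties with complex multiplication and modular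
  functions*, §8.2 Prop. 26, §8.4, §18.2 Lemma (i).  [Lang2002] S. Lang, *Algebra*, GTM 211, V §1 Prop. 1.2, VI §1 Thm. 1.1.
-/

noncomputable section

open CategoryTheory CategoryTheory.Limits NumberField IntermediateField

namespace Summit.HodgeConjecture.CorCM.MultiFieldWeil

open Finset
open Literature.AlgebraicGeometry Literature.AlgebraicGeometry.Motives Literature.AlgebraicGeometry.HodgeTheory
open Literature.AlgebraicGeometry.ComplexMultiplication (IsCMTypeRealisation)
open Literature.AlgebraicTopology.SingularHomology
open Literature.NumberTheory.ComplexMultiplication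

open scoped Classical

variable {k K₀ K₁ K₂ : Type} [Field k] [NumberField k] [IsCMField k] [Field K₀] [NumberField K₀] [IsCMField K₀]
  [Field K₁] [NumberField K₁] [IsCMField K₁] [Field K₂] [NumberField K₂] [IsCMField K₂] {N : ℕ}
  {E T₀ T₁ T₂ : AbelianVariety ℂ} {Ψ : CMType k} {Φ₀ : CMType K₀} {Φ₁ : CMType K₁} {Φ₂ : CMType K₂}
  {ιE : 𝓞 k →+* End E} {θE : k →+* Module.End ℂ (complexBetti E.X 1)}
  {ι₀ : 𝓞 K₀ →+* End T₀} {θ₀ : K₀ →+* Module.End ℂ (complexBetti T₀.X 1)}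
  {ι₁ : 𝓞 K₁ →+* End T₁} {θ₁ : K₁ →+* Module.End ℂ (complexBetti T₁.X 1)}
  {ι₂ : 𝓞 K₂ →+* End T₂} {θ₂ : K₂ →+* Module.End ℂ (complexBetti T₂.X 1)}

/-! ## §1 `vec` form: the three types with one member over `τ` -/

/-- **THREE `(1,2)`-THREEFOLDS — `vec` form.**  `E ⊨ (k; Ψ)` with `τ ∈ Ψ`; `T_m ⊨ (K_m; Φ_m)` over sextic `K_m ⊇ i_m(k)` with exactly one member of `Φ_m` over `τ`;
`Hom(K₁, K₀) = ∅`; `s₀ ⊃ τ`, `s₁ ⊃ τ` embeddings of `K₀`, `K₁` such that no embedding of `K₂` over `τ` has image inside `ℚ(τk) · s₀(K₀) · s₁(K₁)`.  Then the Hodge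
conjecture holds for `⨁_j ![E, T₀, T₁, T₂] (κ j)` for every `κ`, GIVEN ONLY Markman's fourfold theorem (`hodgeConjectureFor_biproduct_comp_of_three_sextics` on the
family `(k, K₀, K₁, K₂)`).  `HC_CM` is NOT asserted. [cite: Markman2025SurveySecant, Thm. 1.2] [cite: Lang2002, V §1 Prop. 1.2, VI §1 Thm. 1.1] -/
theorem hodgeConjectureFor_biproduct_comp_vec_of_three_sextics (hW4 : Markman2025_weilClasses_algebraic_abelianFourfold)
    (h2 : Module.finrank ℚ k = 2) (h6₀ : Module.finrank ℚ K₀ = 6) (h6₁ : Module.finrank ℚ K₁ = 6) (h6₂ : Module.finrank ℚ K₂ = 6)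
    (i₀ : k →+* K₀) (i₁ : k →+* K₁) (i₂ : k →+* K₂)
    (hE : IsCMTypeRealisation Ψ E ιE θE) (hT₀ : IsCMTypeRealisation Φ₀ T₀ ι₀ θ₀) (hT₁ : IsCMTypeRealisation Φ₁ T₁ ι₁ θ₁)
    (hT₂ : IsCMTypeRealisation Φ₂ T₂ ι₂ θ₂) {τ : k →+* ℂ} (hτΨ : τ ∈ Ψ.1)
    (h1₀ : (Finset.univ.filter fun s : K₀ →+* ℂ => s.comp i₀ = τ ∧ s ∈ Φ₀.1).card = 1)
    (h1₁ : (Finset.univ.filter fun s : K₁ →+* ℂ => s.comp i₁ = τ ∧ s ∈ Φ₁.1).card = 1)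
    (h1₂ : (Finset.univ.filter fun s : K₂ →+* ℂ => s.comp i₂ = τ ∧ s ∈ Φ₂.1).card = 1)
    (hK : IsEmpty (K₁ →+* K₀)) {s₀ : K₀ →+* ℂ} {s₁ : K₁ →+* ℂ} (hs₀ : s₀.comp i₀ = τ) (hs₁ : s₁.comp i₁ = τ)
    (hK₂ : ∀ φ : K₂ →+* ℂ, φ.comp i₂ = τ → ¬ Set.range φ ⊆ (↑(adjoin ℚ (Set.range τ) ⊔ adjoin ℚ (Set.range s₀ ∪ Set.range s₁)) : Set ℂ))
    (κ : Fin N → Fin 4) :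
    HodgeConjectureFor (⨁ fun j => (![E, T₀, T₁, T₂] : Fin 4 → AbelianVariety ℂ) (κ j)).dim
      (⨁ fun j => (![E, T₀, T₁, T₂] : Fin 4 → AbelianVariety ℂ) (κ j)).X := by
  have hττ : ComplexEmbedding.conjugate τ ≠ τ := QuarticCM.conjugate_ne τ
  have hk : ∀ σ : k →+* ℂ, σ = τ ∨ σ = ComplexEmbedding.conjugate τ := fun σ => QuarticCM.eq_or_eq_conjugate_of_quadratic h2 τ σ
  have hΨ : ∀ σ : k →+* ℂ, σ ∈ Ψ.1 ↔ σ = τ := by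
    intro σ
    rcases hk σ with rfl | rfl
    · exact ⟨fun _ => rfl, fun _ => hτΨ⟩
    · exact ⟨fun h => absurd h ((Ψ.2 τ).1 hτΨ), fun h => absurd h hττ⟩
  -- the family of fields `(k, K₀, K₁, K₂)` with its instances (all identifications below are definitional)
  let Kf : Fin 4 → Type := Fin.cons k (Fin.cons K₀ (Fin.cons K₁ (Fin.cons K₂ finZeroElim)))
  letI instF : ∀ j, Field (Kf j) := Fin.cons ‹Field k› (Fin.cons ‹Field K₀› (Fin.cons ‹Field K₁› (Fin.cons ‹Field K₂› finZeroElim)))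
  letI instN : ∀ j, NumberField (Kf j) :=
    Fin.cons ‹NumberField k› (Fin.cons ‹NumberField K₀› (Fin.cons ‹NumberField K₁› (Fin.cons ‹NumberField K₂› finZeroElim)))
  haveI instC : ∀ j, IsCMField (Kf j) :=
    Fin.cons ‹IsCMField k› (Fin.cons ‹IsCMField K₀› (Fin.cons ‹IsCMField K₁› (Fin.cons ‹IsCMField K₂› finZeroElim)))
  let Φf : ∀ j : Fin 4, CMType (Kf (mfSlots (0 : Fin 4) Fin.succ j)) := Fin.cons Ψ (Fin.cons Φ₀ (Fin.cons Φ₁ (Fin.cons Φ₂ finZeroElim)))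
  let ιf : ∀ j : Fin 4, 𝓞 (Kf (mfSlots (0 : Fin 4) Fin.succ j)) →+* End ((![E, T₀, T₁, T₂] : Fin 4 → AbelianVariety ℂ) j) :=
    Fin.cons ιE (Fin.cons ι₀ (Fin.cons ι₁ (Fin.cons ι₂ finZeroElim)))
  let θf : ∀ j : Fin 4, Kf (mfSlots (0 : Fin 4) Fin.succ j) →+* Module.End ℂ (complexBetti ((![E, T₀, T₁, T₂] : Fin 4 → AbelianVariety ℂ) j).X 1) :=
    Fin.cons θE (Fin.cons θ₀ (Fin.cons θ₁ (Fin.cons θ₂ finZeroElim)))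
  have hA : ∀ j, IsCMTypeRealisation (Φf j) ((![E, T₀, T₁, T₂] : Fin 4 → AbelianVariety ℂ) j) (ιf j) (θf j) :=
    Fin.cons hE (Fin.cons hT₀ (Fin.cons hT₁ (Fin.cons hT₂ finZeroElim)))
  let im : ∀ m : Fin 3, Kf 0 →+* Kf (Fin.succ m) := Fin.cons i₀ (Fin.cons i₁ (Fin.cons i₂ finZeroElim))
  have h6 : ∀ m : Fin 3, Module.finrank ℚ (Kf (Fin.succ m)) = 6 := by
    intro m
    fin_cases m
    · exact h6₀
    · exact h6₁
    · exact h6₂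
  have h1 : ∀ m : Fin 3, (Finset.univ.filter fun s : Kf (Fin.succ m) →+* ℂ => s.comp (im m) = τ ∧ s ∈ (Φf m.succ).1).card = 1 := by
    intro m
    fin_cases m
    · exact h1₀
    · exact h1₁
    · exact h1₂
  have hK' : IsEmpty (Kf (Fin.succ 1) →+* Kf (Fin.succ 0)) := hK
  have hs₀' : (s₀ : Kf (Fin.succ 0) →+* ℂ).comp (im 0) = τ := hs₀
  have hs₁' : (s₁ : Kf (Fin.succ 1) →+* ℂ).comp (im 1) = τ := hs₁
  have hK₂' : ∀ φ : Kf (Fin.succ 2) →+* ℂ, φ.comp (im 2) = τ →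
      ¬ Set.range φ ⊆ (↑(adjoin ℚ (Set.range τ) ⊔ adjoin ℚ (Set.range (s₀ : Kf (Fin.succ 0) →+* ℂ) ∪ Set.range (s₁ : Kf (Fin.succ 1) →+* ℂ))) : Set ℂ) :=
    hK₂
  exact hodgeConjectureFor_biproduct_comp_of_three_sextics (Kf := Kf) (i₀ := (0 : Fin 4)) (is := Fin.succ)
    (A := (![E, T₀, T₁, T₂] : Fin 4 → AbelianVariety ℂ)) (Φ := Φf) (ι := ιf) (θ := θf) hW4 κ h2 h6 im hA hΨ h1 hK' s₀ s₁ hs₀' hs₁' hK₂'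

/-! ## §2 SIMPLE threefolds: no hypothesis on the types -/

/-- **THREE SIMPLE CM ABELIAN THREEFOLDS WHOSE SEXTIC CM FIELDS CONTAIN `k` — given ONLY Markman's fourfold theorem.**  `k` imaginary quadratic, `E ⊨ (k; Ψ)` a CM
elliptic curve; `T_m ⊨ (K_m; Φ_m)` (`m = 0, 1, 2`) SIMPLE abelian threefolds with CM by sextic CM fields `K_m ⊇ i_m(k)`; FIELD HYPOTHESES: `Hom(K₁, K₀) = ∅`, and for
all embeddings `τ`, `s₀ ⊃ τ`, `s₁ ⊃ τ` no embedding of `K₂` over `τ` has image inside `ℚ(τk) · s₀(K₀) · s₁(K₁)` (no `k`-embedding of `K₂` into a compositum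
`K₀ · K₁`).  Then for every `κ : Fin N → Fin 4` — every `E^a × T₀^b × T₁^c × T₂^d` — every rational `(p,p)`-class on `⨁_j ![E, T₀, T₁, T₂] (κ j)` is algebraic,
GIVEN ONLY `Markman2025_weilClasses_algebraic_abelianFourfold`.  The types are normalised to one member over `τ` on the same varieties (G4's
`exists_realisation_card_eq_one`).  `HC_CM` is NOT asserted. [cite: Markman2025SurveySecant, Thm. 1.2] [cite: Shimura1998, §8.2 Prop. 26, §8.4, §18.2 Lemma (i)] -/
theorem hodgeConjectureFor_biproduct_comp_vec_of_three_simpleThreefolds_of_markman (hW4 : Markman2025_weilClasses_algebraic_abelianFourfold)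
    (h2 : Module.finrank ℚ k = 2) (h6₀ : Module.finrank ℚ K₀ = 6) (h6₁ : Module.finrank ℚ K₁ = 6) (h6₂ : Module.finrank ℚ K₂ = 6)
    (i₀ : k →+* K₀) (i₁ : k →+* K₁) (i₂ : k →+* K₂)
    (hE : IsCMTypeRealisation Ψ E ιE θE) (hT₀ : IsCMTypeRealisation Φ₀ T₀ ι₀ θ₀) (hT₁ : IsCMTypeRealisation Φ₁ T₁ ι₁ θ₁)
    (hT₂ : IsCMTypeRealisation Φ₂ T₂ ι₂ θ₂) (hS₀ : T₀.IsSimple) (hS₁ : T₁.IsSimple) (hS₂ : T₂.IsSimple) (hK : IsEmpty (K₁ →+* K₀))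
    (hK₂ : ∀ (τ : k →+* ℂ) (s₀ : K₀ →+* ℂ) (s₁ : K₁ →+* ℂ) (φ : K₂ →+* ℂ), s₀.comp i₀ = τ → s₁.comp i₁ = τ → φ.comp i₂ = τ →
      ¬ Set.range φ ⊆ (↑(adjoin ℚ (Set.range τ) ⊔ adjoin ℚ (Set.range s₀ ∪ Set.range s₁)) : Set ℂ))
    (κ : Fin N → Fin 4) :
    HodgeConjectureFor (⨁ fun j => (![E, T₀, T₁, T₂] : Fin 4 → AbelianVariety ℂ) (κ j)).dim
      (⨁ fun j => (![E, T₀, T₁, T₂] : Fin 4 → AbelianVariety ℂ) (κ j)).X := by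
  obtain ⟨τ, hτΨ⟩ := exists_mem_cmType Ψ
  obtain ⟨Φ₀', ι₀', θ₀', hT₀', h1₀⟩ := exists_realisation_card_eq_one h6₀ h2 i₀ hT₀ τ (card_filter_mem_eq_one_or_two_of_isSimple h6₀ h2 i₀ hT₀ hS₀ τ)
  obtain ⟨Φ₁', ι₁', θ₁', hT₁', h1₁⟩ := exists_realisation_card_eq_one h6₁ h2 i₁ hT₁ τ (card_filter_mem_eq_one_or_two_of_isSimple h6₁ h2 i₁ hT₁ hS₁ τ)
  obtain ⟨Φ₂', ι₂', θ₂', hT₂', h1₂⟩ := exists_realisation_card_eq_one h6₂ h2 i₂ hT₂ τ (card_filter_mem_eq_one_or_two_of_isSimple h6₂ h2 i₂ hT₂ hS₂ τ)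
  -- embeddings of `K₀`, `K₁` over `τ`
  obtain ⟨s₀, hs₀⟩ : ∃ s : K₀ →+* ℂ, s.comp i₀ = τ := by
    have hc := SexticOcticWeil.card_filter_comp_eq_of_finrank (n := 3) i₀ (by rw [h6₀]) h2 τ
    obtain ⟨s, hs⟩ := Finset.card_pos.1 (by rw [hc]; norm_num)
    exact ⟨s, (Finset.mem_filter.1 hs).2⟩
  obtain ⟨s₁, hs₁⟩ : ∃ s : K₁ →+* ℂ, s.comp i₁ = τ := by
    have hc := SexticOcticWeil.card_filter_comp_eq_of_finrank (n := 3) i₁ (by rw [h6₁]) h2 τ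
    obtain ⟨s, hs⟩ := Finset.card_pos.1 (by rw [hc]; norm_num)
    exact ⟨s, (Finset.mem_filter.1 hs).2⟩
  exact hodgeConjectureFor_biproduct_comp_vec_of_three_sextics hW4 h2 h6₀ h6₁ h6₂ i₀ i₁ i₂ hE hT₀' hT₁' hT₂' hτΨ h1₀ h1₁ h1₂ hK hs₀ hs₁
    (fun φ hφ => hK₂ τ s₀ s₁ φ hs₀ hs₁ hφ) κ

/-- **Dominated form**: every abelian variety dominated by a product of copies of `E`, `T₀`, `T₁`, `T₂` satisfies the Hodge conjecture, given only Markman's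
fourfold theorem. [cite: Markman2025SurveySecant, Thm. 1.2] [cite: MumfordAV1970, §19 Thm. 1 and p. 169] -/
theorem hodgeConjectureFor_of_avDominatedBy_comp_vec_of_three_simpleThreefolds_of_markman (hW4 : Markman2025_weilClasses_algebraic_abelianFourfold)
    (h2 : Module.finrank ℚ k = 2) (h6₀ : Module.finrank ℚ K₀ = 6) (h6₁ : Module.finrank ℚ K₁ = 6) (h6₂ : Module.finrank ℚ K₂ = 6)
    (i₀ : k →+* K₀) (i₁ : k →+* K₁) (i₂ : k →+* K₂)
    (hE : IsCMTypeRealisation Ψ E ιE θE) (hT₀ : IsCMTypeRealisation Φ₀ T₀ ι₀ θ₀) (hT₁ : IsCMTypeRealisation Φ₁ T₁ ι₁ θ₁)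
    (hT₂ : IsCMTypeRealisation Φ₂ T₂ ι₂ θ₂) (hS₀ : T₀.IsSimple) (hS₁ : T₁.IsSimple) (hS₂ : T₂.IsSimple) (hK : IsEmpty (K₁ →+* K₀))
    (hK₂ : ∀ (τ : k →+* ℂ) (s₀ : K₀ →+* ℂ) (s₁ : K₁ →+* ℂ) (φ : K₂ →+* ℂ), s₀.comp i₀ = τ → s₁.comp i₁ = τ → φ.comp i₂ = τ →
      ¬ Set.range φ ⊆ (↑(adjoin ℚ (Set.range τ) ⊔ adjoin ℚ (Set.range s₀ ∪ Set.range s₁)) : Set ℂ))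
    (κ : Fin N → Fin 4) {X : AbelianVariety ℂ} (hX : Domination.AVDominatedBy X (⨁ fun j => (![E, T₀, T₁, T₂] : Fin 4 → AbelianVariety ℂ) (κ j))) :
    HodgeConjectureFor X.dim X.X :=
  Domination.hodgeConjectureFor_of_avDominatedBy
    (hodgeConjectureFor_biproduct_comp_vec_of_three_simpleThreefolds_of_markman hW4 h2 h6₀ h6₁ h6₂ i₀ i₁ i₂ hE hT₀ hT₁ hT₂ hS₀ hS₁ hS₂ hK hK₂ κ) hX

end Summit.HodgeConjecture.CorCM.MultiFieldWeil

end
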